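import Mathlib
import Summits.Ventures.PercRepro.PuncturedLYMMixP1Q1Table1
import Summits.Ventures.PercRepro.PuncturedLYMMixP1Q1PosDen1
import Summits.Ventures.PercRepro.PuncturedLYMMixP1Q1PosCls1

/-!
# PercRepro — (SP) FOR `1` PAIRWISE DISJOINT PAIRS AND `1` PAIRWISE DISJOINT QUADRUPLES AT LEVEL `4`: POSITIVITY OF THE TABLE
(p10, gen 41)

`sel_nonneg` by the class guards and `raw_nonneg`.  Nothing here asserts (SP).
-/

namespace PercRepro.PuncturedLYM.Split.TypeLift.MixP1Q1

/-- Every numerator of the table is nonnegative on its class (sequential case split on the class guards). -/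
theorem sel_nonneg (n : ℚ) (c21 c41 c42 c43 v : ℕ) (hf : (4 : ℚ) - c21 - c41 - 2 * c42 - 3 * c43 ≤ n - 6) : 0 ≤ sel c21 c41 c42 c43 v n := by
  unfold sel
  by_cases g1 : c21 = 0 ∧ c41 = 0 ∧ c42 = 0 ∧ c43 = 0
  · rw [if_pos g1]
    obtain ⟨rfl, rfl, rfl, rfl⟩ := g1
    exact sel_0000_nonneg n v (by push_cast at hf; linarith)
  rw [if_neg g1]
  by_cases g2 : c21 = 0 ∧ c41 = 0 ∧ c42 = 0 ∧ c43 = 1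
  · rw [if_pos g2]
    obtain ⟨rfl, rfl, rfl, rfl⟩ := g2
    exact sel_0001_nonneg n v (by push_cast at hf; linarith)
  rw [if_neg g2]
  by_cases g3 : c21 = 0 ∧ c41 = 0 ∧ c42 = 1 ∧ c43 = 0
  · rw [if_pos g3]
    obtain ⟨rfl, rfl, rfl, rfl⟩ := g3
    exact sel_0010_nonneg n v (by push_cast at hf; linarith)
  rw [if_neg g3]
  by_cases g4 : c21 = 0 ∧ c41 = 1 ∧ c42 = 0 ∧ c43 = 0
  · rw [if_pos g4]
    obtain ⟨rfl, rfl, rfl, rfl⟩ := g4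
    exact sel_0100_nonneg n v (by push_cast at hf; linarith)
  rw [if_neg g4]
  by_cases g5 : c21 = 1 ∧ c41 = 0 ∧ c42 = 0 ∧ c43 = 0
  · rw [if_pos g5]
    obtain ⟨rfl, rfl, rfl, rfl⟩ := g5
    exact sel_1000_nonneg n v (by push_cast at hf; linarith)
  rw [if_neg g5]
  by_cases g6 : c21 = 1 ∧ c41 = 0 ∧ c42 = 0 ∧ c43 = 1
  · rw [if_pos g6]
    obtain ⟨rfl, rfl, rfl, rfl⟩ := g6
    exact sel_1001_nonneg n v (by push_cast at hf; linarith)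
  rw [if_neg g6]
  by_cases g7 : c21 = 1 ∧ c41 = 0 ∧ c42 = 1 ∧ c43 = 0
  · rw [if_pos g7]
    obtain ⟨rfl, rfl, rfl, rfl⟩ := g7
    exact sel_1010_nonneg n v (by push_cast at hf; linarith)
  rw [if_neg g7]
  by_cases g8 : c21 = 1 ∧ c41 = 1 ∧ c42 = 0 ∧ c43 = 0
  · rw [if_pos g8]
    obtain ⟨rfl, rfl, rfl, rfl⟩ := g8
    exact sel_1100_nonneg n v (by push_cast at hf; linarith)
  rw [if_neg g8]

/-- The unnormalised weights are nonnegative on their classes. -/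
theorem raw_nonneg (n : ℚ) (c21 c41 c42 c43 v : ℕ) (hn0 : 6 ≤ n) (hf : (4 : ℚ) - c21 - c41 - 2 * c42 - 3 * c43 ≤ n - 6) : 0 ≤ raw n c21 c41 c42 c43 v := by
  unfold raw
  have hd := den_pos n (by linarith)
  exact div_nonneg (sel_nonneg n c21 c41 c42 c43 v hf) (by positivity)

end PercRepro.PuncturedLYM.Split.TypeLift.MixP1Q1
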